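import Mathlib
import Literature.Barriers.Schanuel.LargeTranscendenceDegreeThm29Holds
import Summits.Schanuel.Schanuel.Theorems.RigidCoreSchanuelOnLogFreeCoreDiazAnyBase
import Summits.Schanuel.Schanuel.Theorems.RigidCoreSchanuelOnLogFreeCoreCalibrationR

/-!
# The small power grid `(1, u) × (1, u, u²)`: two algebraically independent numbers among
# `u, e, e^u, e^{u²}, e^{u³}` for every `u` of degree `≥ 3` (stub `stub_smallGridPowerCell`)

Registered calibration stub C16 `stub_smallGridPowerCell` of line `sector-split` (skeleton v22,
lead c11) of crux `stmt-Schanuel-0970` (`Summit.Schanuel.Schanuel.Theses.RigidCore.SchanuelOnLogFreeCore`,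
(R): Schanuel's conjecture for `ℚ`-linearly independent tuples of the log-free core `C_EA`).

A CALIBRATION of (R), off the path to the crux.  Theorem 2.9 of Nesterenko–Philippon (eds.),
LNM 1752, Ch. 14 — clause `t₂`, `dℓ > d + ℓ`, NO Technical Hypothesis (Gel'fond's method with
Tijdeman's zero estimate), PROVED in the tree as `Literature.Barriers.Schanuel.smallTrdeg_thm_2_9_pos_holds`
— applied to the grid `x = (1, u)`, `y = (1, u, u²)` (`(d, ℓ) = (2, 3)`, `6 > 5`) gives, for EVERY complex
`u` whose powers `1, u, u²` are `ℚ`-linearly independent (i.e. `u` of degree `≥ 3` over `ℚ`, in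
particular every transcendental `u`):

  `2 ≤ trdeg_ℚ ℚ(u, e, e^u, e^{u²}, e^{u³})`   (`stub_smallGridPowerCell`).

For a transcendental CORE point `u ∈ C_EA` the 4-tuple `z = (1, u, u², u³)` is a `ℚ`-free core tuple,
(R) demands `4 ≤ trdeg ℚ(z, e^z) = trdeg ℚ(u, e, e^u, e^{u²}, e^{u³})`, and `2` of it holds
unconditionally through EVERY such point (`SmallGridPowerCell.cruxCell`) — the TH-free companion of the
measured grids of `RigidCoreSchanuelOnLogFreeCoreExpOnePowersTH.lean` (`u = e`, credit `≈ N/4` on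
`(1, e, …, e^{N−1})`) and `…PiRealGridBound.lean` (`u = π`).  At `u = e`: two of `e, e^e, e^{e²}, e^{e³}`
are algebraically independent (Brownawell–Waldschmidt's theorem gives only "`e^e`, `e^{e²}` not both
algebraic").

Auxiliaries in the sub-namespace `…RigidCore.SmallGridPowerCell`; only the registered stub is declared
directly in `Summit.Schanuel.Schanuel.Theorems.RigidCore`.  No definitions.

## References

* Yu. V. Nesterenko, P. Philippon (eds.), *Introduction to Algebraic Independence Theory*, LNM 1752,
  Springer (2001), Ch. 14, Theorem 2.9 (clause `t₂`). [NesterenkoPhilippon2001]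
-/

noncomputable section

namespace Summit.Schanuel.Schanuel.Theorems.RigidCore

namespace SmallGridPowerCell

/-- The grid field `gridField₂ x y` for `x = (uⁱ)_{i<2}`, `y = (uʲ)_{j<3}` lies in
`ℚ(u, e^{u^k} : k < 4)`: the generators are powers of `u` and the `e^{uⁱuʲ} = e^{u^{i+j}}`, `i + j ≤ 3`.
[folklore] -/
theorem gridField₂_le_explicit (u : ℂ) :
    Literature.Barriers.Schanuel.gridField₂ (fun i : Fin 2 => u ^ (i : ℕ)) (fun j : Fin 3 => u ^ (j : ℕ)) ≤
      IntermediateField.adjoin ℚ ({u} ∪ Set.range (fun k : Fin 4 => Complex.exp (u ^ (k : ℕ)))) := by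
  set E := IntermediateField.adjoin ℚ ({u} ∪ Set.range (fun k : Fin 4 => Complex.exp (u ^ (k : ℕ))))
    with hE
  have huE : u ∈ E := IntermediateField.subset_adjoin _ _ (Set.mem_union_left _ rfl)
  rw [Literature.Barriers.Schanuel.gridField₂]
  refine IntermediateField.adjoin_le_iff.mpr ?_
  rintro z ((⟨i, rfl⟩ | ⟨j, rfl⟩) | ⟨p, rfl⟩)
  · exact pow_mem huE _
  · exact pow_mem huE _
  · have hlt : (p.1 : ℕ) + (p.2 : ℕ) < 4 := by
      have h1 := p.1.is_lt; have h2 := p.2.is_lt; omega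
    refine IntermediateField.subset_adjoin _ _ (Set.mem_union_right _ ⟨⟨_, hlt⟩, ?_⟩)
    simp [pow_add]

/-- Linear independence of `(1, u)` from that of `(1, u, u²)` (restriction along `Fin 2 ↪ Fin 3`).
[folklore] -/
theorem linearIndependent_pow_two {u : ℂ} (h : LinearIndependent ℚ (fun i : Fin 3 => u ^ (i : ℕ))) :
    LinearIndependent ℚ (fun i : Fin 2 => u ^ (i : ℕ)) :=
  h.comp (Fin.castLE (by norm_num)) (Fin.castLE_injective _)

end SmallGridPowerCell

/-- **Registered stub `stub_smallGridPowerCell` of line `sector-split`** (calibration C16, signature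
verbatim): for every `u ∈ ℂ` with `1, u, u²` linearly independent over `ℚ`,
`2 ≤ trdeg_ℚ ℚ(u, e, e^u, e^{u²}, e^{u³})` — Theorem 2.9 of LNM 1752, Ch. 14, clause `t₂` (PROVED in
the tree, no Technical Hypothesis) on the grid `x = (1, u)`, `y = (1, u, u²)`, whose field
`ℚ(x, y, e^{xᵢyⱼ})` is `ℚ(u, e^{u^k} : k ≤ 3)`. [cite: NesterenkoPhilippon2001, Ch. 14 Thm 2.9 (t₂)] -/
theorem stub_smallGridPowerCell :
    ∀ u : ℂ, LinearIndependent ℚ (fun i : Fin 3 => u ^ (i : ℕ)) →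
      ((2 : ℕ) : Cardinal) ≤ Algebra.trdeg ℚ ↥(IntermediateField.adjoin ℚ
        ({u} ∪ Set.range (fun k : Fin 4 => Complex.exp (u ^ (k : ℕ))))) := by
  intro u hu
  have h := Literature.Barriers.Schanuel.smallTrdeg_thm_2_9_pos_holds.two_le_trdeg_gridField₂
    (fun i : Fin 2 => u ^ (i : ℕ)) (fun j : Fin 3 => u ^ (j : ℕ))
    (SmallGridPowerCell.linearIndependent_pow_two hu) hu (by norm_num)
  exact_mod_cast h.trans (Literature.Barriers.Schanuel.trdeg_mono
    (SmallGridPowerCell.gridField₂_le_explicit u))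

namespace SmallGridPowerCell

open Summit.Schanuel.Schanuel.Theorems.AclSubsetLogFreeCore.Negative

/-- The powers `1, u, …, u^{N−1}` of a transcendental number are `ℚ`-linearly independent.
[folklore] -/
theorem linearIndependent_pow_of_transcendental {u : ℂ} (hu : Transcendental ℚ u) (N : ℕ) :
    LinearIndependent ℚ (fun k : Fin N => u ^ (k : ℕ)) := by
  rw [Fintype.linearIndependent_iff]
  intro g hg l
  set p : Polynomial ℚ := ∑ i : Fin N, Polynomial.monomial (i : ℕ) (g i) with hp
  have hpt : Polynomial.aeval u p = 0 := by
    simp only [hp, map_sum, Polynomial.aeval_monomial, ← Algebra.smul_def]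
    exact hg
  have hp0 : p = 0 := by
    by_contra hne
    exact hu ⟨p, hne, hpt⟩
  have hcoeff : p.coeff (l : ℕ) = g l := by
    simp only [hp, Polynomial.finsetSum_coeff, Polynomial.coeff_monomial]
    rw [Finset.sum_eq_single l]
    · simp
    · intro b _ hb
      rw [if_neg]
      exact fun h => hb (Fin.ext h)
    · intro h; exact absurd (Finset.mem_univ l) h
  rw [← hcoeff, hp0, Polynomial.coeff_zero]

/-- **The small power cell through a transcendental core point.**  For `u ∈ C_EA` transcendental, the
4-tuple `z = (1, u, u², u³)` is a `ℚ`-free core tuple (so (R) demands `4` on it,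
`powerCell_demand_of_crux`) and, unconditionally, `2 ≤ trdeg ℚ(z, e^z)`.
[cite: NesterenkoPhilippon2001, Ch. 14 Thm 2.9 (t₂)] -/
theorem cruxCell {u : ℂ} (hu : u ∈ logFreeCore) (ht : Transcendental ℚ u) :
    (∀ k : Fin 4, u ^ (k : ℕ) ∈ logFreeCore) ∧
    LinearIndependent ℚ (fun k : Fin 4 => u ^ (k : ℕ)) ∧
    ((2 : ℕ) : Cardinal) ≤ Algebra.trdeg ℚ
      ↥(IntermediateField.adjoin ℚ (Set.range (fun k : Fin 4 => u ^ (k : ℕ)) ∪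
        Set.range (Complex.exp ∘ fun k : Fin 4 => u ^ (k : ℕ)))) := by
  refine ⟨fun _ => pow_mem hu _, linearIndependent_pow_of_transcendental ht 4,
    (stub_smallGridPowerCell u (linearIndependent_pow_of_transcendental ht 3)).trans
      (Literature.Barriers.Schanuel.trdeg_mono (IntermediateField.adjoin.mono _ _ _ ?_))⟩
  rintro z (rfl | ⟨k, rfl⟩)
  · exact Set.mem_union_left _ ⟨⟨1, by norm_num⟩, by simp⟩
  · exact Set.mem_union_right _ ⟨k, rfl⟩

/-- The demand side, by the crux's name: (R) asks for the full `N` on `(u^k)_{k<N}` for every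
transcendental core `u` (here the relevant case is `N = 4`). -/
theorem powerCell_demand_of_crux (hR : Summit.Schanuel.Schanuel.Theses.RigidCore.SchanuelOnLogFreeCore)
    {u : ℂ} (hu : u ∈ logFreeCore) (ht : Transcendental ℚ u) (N : ℕ) :
    (N : Cardinal) ≤ Algebra.trdeg ℚ
      ↥(IntermediateField.adjoin ℚ (Set.range (fun k : Fin N => u ^ (k : ℕ)) ∪
        Set.range (Complex.exp ∘ fun k : Fin N => u ^ (k : ℕ)))) :=
  hR N _ (fun _ => pow_mem hu _) (linearIndependent_pow_of_transcendental ht N)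

/-- **At the core point `u = e`: two of `e, e^e, e^{e²}, e^{e³}` are algebraically independent**
(`2 ≤ trdeg ℚ(e, e^{e^k} : k ≤ 3)`; Hermite supplies the linear independence of `1, e, e²`).
[cite: NesterenkoPhilippon2001, Ch. 14 Thm 2.9 (t₂)] -/
theorem two_le_trdeg_exp_one_cell :
    ((2 : ℕ) : Cardinal) ≤ Algebra.trdeg ℚ ↥(IntermediateField.adjoin ℚ
      ({Complex.exp 1} ∪ Set.range (fun k : Fin 4 => Complex.exp ((Complex.exp 1) ^ (k : ℕ))))) :=
  stub_smallGridPowerCell _ (linearIndependent_pow_of_transcendental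
    (Literature.NumberTheory.Transcendental.transcendental_exp_holds isAlgebraic_one one_ne_zero) 3)

/-- The same cell in (R)-form at `u = e` (core membership `DiazAnyBase.exp_one_mem_logFreeCore`). -/
theorem cruxCell_exp_one :
    (∀ k : Fin 4, (Complex.exp 1) ^ (k : ℕ) ∈ logFreeCore) ∧
    LinearIndependent ℚ (fun k : Fin 4 => (Complex.exp 1) ^ (k : ℕ)) ∧
    ((2 : ℕ) : Cardinal) ≤ Algebra.trdeg ℚ
      ↥(IntermediateField.adjoin ℚ (Set.range (fun k : Fin 4 => (Complex.exp 1) ^ (k : ℕ)) ∪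
        Set.range (Complex.exp ∘ fun k : Fin 4 => (Complex.exp 1) ^ (k : ℕ)))) :=
  cruxCell DiazAnyBase.exp_one_mem_logFreeCore
    (Literature.NumberTheory.Transcendental.transcendental_exp_holds isAlgebraic_one one_ne_zero)

end SmallGridPowerCell

end Summit.Schanuel.Schanuel.Theorems.RigidCore

end
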